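import Summits.CriticalPhenomena.PercolationContinuityZ3.Theorems.Transplant.SkelFrmFrom1ParamsPO
import Summits.CriticalPhenomena.PercolationContinuityZ3.Theorems.Transplant.SkelFrm1ParamsPO
import Summits.CriticalPhenomena.PercolationContinuityZ3.Theorems.Transplant.SkelNeg1ParamsP
import Summits.CriticalPhenomena.PercolationContinuityZ3.Theorems.Transplant.SkelPhiConcExcessRadius
import Summits.CriticalPhenomena.PercolationContinuityZ3.Theorems.Transplant.SkelPhiStepINegOrient
import Summits.CriticalPhenomena.PercolationContinuityZ3.Theorems.Transplant.SkelNegBParamsExcess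
import Summits.CriticalPhenomena.PercolationContinuityZ3.Theorems.Transplant.PlanarSkeletonFrmFromDefs
import Summits.CriticalPhenomena.PercolationContinuityZ3.Theorems.Transplant.PlanarSkeletonFrmDefs
import Summits.CriticalPhenomena.PercolationContinuityZ3.Theorems.Transplant.SkelPhiStepIDataNS
import HarnessLib
import Summits.CriticalPhenomena.PercolationContinuityZ3.Theorems.Transplant.SkelFrmBParamsExcess
/-!
# U-WAVE PORT (RULING D-U, lead g21 2026-08-26; WAVE-U-MANIFEST v3.0 row «SkelFrmBParamsExcess» ↦ «SkelFrmFromBParamsExcess») of the tree module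
# `Transplant/SkelFrmBParamsExcess` onto the carrier `PlanarSkeletonFrmFrom` (frames only, cylinders connected from width `ℓ₀` on)

ORIGINAL TITLE: N2 (frames-only node `SamePDropOfSkeletonFrm₁`, OPEN) params column over `PlanarSkeletonFrm` — (ζ″) ledger, shape (B′) of record ((R-14)):

builds on p205010 (kernel theorem, internal audit signed; external expert review pending) — nothing in this file uses p205010; NOTHING is claimed about the
OPEN node U `SamePDropOfSkeletonFrmFrom₁` (nor U_s / the end state).  Lane `prim-bschramm`, seat `prim-bschramm-p3` gen 26; helper file
(`--supports stmt-CriticalPhenomena-4575 --as helper`).  PORT RULES r1–r4 of RULING D-U: declaration order and proof texts are those of the original,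
byte-identical except (i) the carrier token `PlanarSkeletonFrm ↦ PlanarSkeletonFrmFrom` (binders, `namespace`/`end` lines, qualified names of twinned
declarations), (ii) carrier-FREE declarations of the original (φ-level `Skelφ…` blocks and namespace-only arithmetic residents) are NOT re-declared —
this file imports the original and `export`s the twin-free residents (POLICY T / treatment (m1)); residents whose statement mentions a twinned
constant are copied, (iii) every carrier-binding declaration keeps its explicit binder `(Φ : PlanarSkeletonFrmFrom G)` in its own signature (r2).  Docstrings and citations are the original's.
-/

noncomputable section

open scoped Classical

namespace Summit.CriticalPhenomena.PercolationContinuityZ3.Theorems.Transplant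

namespace PlanarSkeletonFrmFrom

namespace NegB

open MeasureTheory Literature.Probability.Percolation Literature.Probability.LatticeModels SimpleGraph
open Literature.Barriers.CriticalPhenomena (graphBall)
open SkelConc (Consts)
open Skelφ (oriφ trφ)
open Skel (excess)

section Rex

/-! ## §1 The excess radius of record -/

/-- **THE EXCESS RADIUS OF RECORD at the running density `q`** (planar diameter `m`, tolerance `η = δkit/2`): the monotone hull over entrance depths `0 … n+1` of
`Skelφ.excessRadiusAtK Φ.frame Φ.degree_le m η q`. [cite: KozmaNitzan2024, §4 Lemma 12 (p. 24)] -/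
def Rex (κ : Consts) {V : Type} [Countable V] {G : SimpleGraph V} [G.LocallyFinite] (Φ : PlanarSkeletonFrmFrom G) (m : ℕ) (q : unitInterval) : ℕ → ℕ := fun n =>
  (Finset.range (n + 2)).sup fun i => Skelφ.excessRadiusAtK (G := G) (φ := Φ.φ) (types := Φ.types) Φ.frame Φ.degree_le m (Neg.η κ Φ) q i

/-- Every depth `i ≤ n + 1` is dominated: `excessRadiusAtK … i ≤ Rex n`. [folklore] -/
theorem le_Rex (κ : Consts) {V : Type} [Countable V] {G : SimpleGraph V} [G.LocallyFinite] (Φ : PlanarSkeletonFrmFrom G) (m : ℕ) (q : unitInterval) {i n : ℕ} (h : i ≤ n + 1) :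
    Skelφ.excessRadiusAtK (G := G) (φ := Φ.φ) (types := Φ.types) Φ.frame Φ.degree_le m (Neg.η κ Φ) q i ≤ Rex κ Φ m q n :=
  Finset.le_sup (f := fun i => Skelφ.excessRadiusAtK (G := G) (φ := Φ.φ) (types := Φ.types) Φ.frame Φ.degree_le m (Neg.η κ Φ) q i)
    (Finset.mem_range.2 (by omega))

/-- The depth-`ρ+1` radius is dominated by `Rex ρ` ((F)/(R) read `R₁ ρ := Rex ρ`). [folklore] -/
theorem le_Rex_succ (κ : Consts) {V : Type} [Countable V] {G : SimpleGraph V} [G.LocallyFinite] (Φ : PlanarSkeletonFrmFrom G) (m : ℕ) (q : unitInterval) (ρ : ℕ) :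
    Skelφ.excessRadiusAtK (G := G) (φ := Φ.φ) (types := Φ.types) Φ.frame Φ.degree_le m (Neg.η κ Φ) q (ρ + 1) ≤ Rex κ Φ m q ρ :=
  le_Rex κ Φ m q le_rfl

/-- `Rex` is monotone in the depth. [folklore] -/
theorem Rex_mono (κ : Consts) {V : Type} [Countable V] {G : SimpleGraph V} [G.LocallyFinite] (Φ : PlanarSkeletonFrmFrom G) (m : ℕ) (q : unitInterval) {n n' : ℕ} (h : n ≤ n') : Rex κ Φ m q n ≤ Rex κ Φ m q n' :=
  Finset.sup_mono (Finset.range_subset_range.2 (Nat.add_le_add_right h 2))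

/-- `Rex` is `Monotone` (D″'s `SchedIn.Rex` shape). [folklore] -/
theorem Rex_monotone (κ : Consts) {V : Type} [Countable V] {G : SimpleGraph V} [G.LocallyFinite] (Φ : PlanarSkeletonFrmFrom G) (m : ℕ) (q : unitInterval) : Monotone (Rex κ Φ m q) := fun _ _ h => Rex_mono κ Φ m q h

/-! ## §2 The planar box is orientation-free -/

/-- For either orientation `o`, `oriφ Φ.φ o d − oriφ Φ.φ o d' ∈ box 2 m ↔ Φ.φ d − Φ.φ d' ∈ box 2 m`. [folklore] -/
theorem sub_mem_box_oriφ {V : Type} {G : SimpleGraph V} [G.LocallyFinite] (Φ : PlanarSkeletonFrmFrom G) (o : Bool) (d d' : V) (m : ℕ) : oriφ Φ.φ o d - oriφ Φ.φ o d' ∈ box 2 m ↔ Φ.φ d - Φ.φ d' ∈ box 2 m := by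
  cases o
  · simp only [Skelφ.oriφ_false]; exact Skelφ.sub_mem_box_trφ Φ.φ d' d m
  · simp only [Skelφ.oriφ_true]

/-! ## §3 The residues' excess hypotheses, discharged -/

/-- **`hR₁` ((F) `faceOblRM_fineN`, (R) `real_rootRim_le`) at EVERY centre `c`, EITHER orientation `o`, any tolerance `η' ≥ η`**: beyond `Rex ρ`, every habitat
`D' ⊆ B_G(c, Rw)` of `oriφ Φ.φ o`-diameter `≤ m` with entrances `A' ⊆ D'` at depth `≤ ρ + 1` has `P_q(excess c R' D' A') ≤ η'`. [cite: KozmaNitzan2024, §4 Lemma 12 (p. 24)] -/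
theorem hR₁_at (κ : Consts) {V : Type} [Countable V] {G : SimpleGraph V} [G.LocallyFinite] (Φ : PlanarSkeletonFrmFrom G) (m : ℕ) {q : unitInterval} (hC : Φ.CylSubcritical q) (o : Bool) {η' : ℝ} (hη' : Neg.η κ Φ ≤ η') (c : V) :
    ∀ ρ R', Rex κ Φ m q ρ ≤ R' → ∀ (Rw : ℕ) (D' A' : Finset V), (∀ d ∈ D', d ∈ graphBall G c Rw) →
      (∀ d ∈ D', ∀ d' ∈ D', oriφ Φ.φ o d - oriφ Φ.φ o d' ∈ box 2 m) → A' ⊆ D' → (∀ a ∈ A', a ∈ graphBall G c (ρ + 1)) →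
        (bondPercolation G q).real (excess G c R' D' A') ≤ η' := by
  intro ρ R' hR Rw D' A' hD hm hAD hA
  have hm' : ∀ d ∈ D', ∀ d' ∈ D', Φ.φ d - Φ.φ d' ∈ box 2 m := fun d hd d' hd' => (sub_mem_box_oriφ Φ o d d' m).1 (hm d hd d' hd')
  exact Skelφ.excessRadiusAtK_spec_le Φ.frame Φ.degree_le m (Neg.η_pos κ Φ).1 hη' hC (ρ + 1) c R' ((le_Rex_succ κ Φ m q ρ).trans hR) Rw D' A' hD hm' hAD hA

/-- **`hRex` ((C) `reachOblRHN_negSG₂`) at EVERY centre `c`, EITHER orientation, any `η' ≥ η`**: beyond `Rex R₀'`, habitats of `oriφ`-diameter `≤ m` with entrances at depth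
`≤ R₀'` have excess `≤ η'` (the (C) wrapper converts its fine-map diameter `50·rmax` to `m` by `NegB.φ_extent_fine_at`). [cite: KozmaNitzan2024, §4 Lemma 12 (p. 24)] -/
theorem hRex_at (κ : Consts) {V : Type} [Countable V] {G : SimpleGraph V} [G.LocallyFinite] (Φ : PlanarSkeletonFrmFrom G) (m : ℕ) {q : unitInterval} (hC : Φ.CylSubcritical q) (o : Bool) {η' : ℝ} (hη' : Neg.η κ Φ ≤ η') (c : V) :
    ∀ R₀' R₁, Rex κ Φ m q R₀' ≤ R₁ → ∀ (Rw : ℕ) (D' A' : Finset V), (∀ d ∈ D', d ∈ graphBall G c Rw) →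
      (∀ d ∈ D', ∀ d' ∈ D', oriφ Φ.φ o d - oriφ Φ.φ o d' ∈ box 2 m) → A' ⊆ D' → (∀ a ∈ A', a ∈ graphBall G c R₀') →
        (bondPercolation G q).real (excess G c R₁ D' A') ≤ η' := by
  intro R₀' R₁ hR Rw D' A' hD hm hAD hA
  have hm' : ∀ d ∈ D', ∀ d' ∈ D', Φ.φ d - Φ.φ d' ∈ box 2 m := fun d hd d' hd' => (sub_mem_box_oriφ Φ o d d' m).1 (hm d hd d' hd')
  exact Skelφ.excessRadiusAtK_spec_le Φ.frame Φ.degree_le m (Neg.η_pos κ Φ).1 hη' hC R₀' c R₁ ((le_Rex κ Φ m q (by omega)).trans hR) Rw D' A' hD hm' hAD hA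

/-- The unoriented forms (`o = true`: the map `Φ.φ` itself). [folklore] -/
theorem hR₁_at_φ (κ : Consts) {V : Type} [Countable V] {G : SimpleGraph V} [G.LocallyFinite] (Φ : PlanarSkeletonFrmFrom G) (m : ℕ) {q : unitInterval} (hC : Φ.CylSubcritical q) {η' : ℝ} (hη' : Neg.η κ Φ ≤ η') (c : V) :
    ∀ ρ R', Rex κ Φ m q ρ ≤ R' → ∀ (Rw : ℕ) (D' A' : Finset V), (∀ d ∈ D', d ∈ graphBall G c Rw) →
      (∀ d ∈ D', ∀ d' ∈ D', Φ.φ d - Φ.φ d' ∈ box 2 m) → A' ⊆ D' → (∀ a ∈ A', a ∈ graphBall G c (ρ + 1)) →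
        (bondPercolation G q).real (excess G c R' D' A') ≤ η' :=
  hR₁_at κ Φ m hC true hη' c

end Rex

end NegB

end PlanarSkeletonFrmFrom

end Summit.CriticalPhenomena.PercolationContinuityZ3.Theorems.Transplant

end
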